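import Literature.NumberTheory.BeurlingPrimes.LiSeries
import Literature.NumberTheory.BeurlingPrimes.LogZetaMellin
import Literature.NumberTheory.BeurlingPrimes.BVPrimeSurgery
import Mathlib.NumberTheory.Harmonic.Bounds
import Mathlib.Analysis.Complex.ExponentialBounds
import HarnessLib

/-!
# `π_𝒫(x) = li(x) + O(1)` implies `Π_𝒫(x) = Li(x) + O(log log x)` (Broucke–Vindas 2024, proof of Theorem 3.1)

Topic `Literature/NumberTheory/BeurlingPrimes`. Everything in this file is PROVED.

Broucke–Vindas (2024), proof of Theorem 3.1: "We thus find generalized primes `𝒫 : 1 < p₁ < p₂ < …` with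
`π_𝒫(x) = li(x) + O(1)` … The Riemann prime counting function `Π` of `𝒫` satisfies
`Π(x) = Σ_{ν=1}^{⌊log x/log p₁⌋} (1/ν) π(x^{1/ν}) = Σ_{ν ≤ ⌊log x/log p₁⌋} (1/ν)(li(x^{1/ν}) + O(1))
 = Σ_ν Σ_n (log x)ⁿ/(n! n ζ(n+1)) ν^{−n−1} − Σ_{ν > ⌊log x/log p₁⌋} Σ_n (log x)ⁿ/(n! n ζ(n+1)) ν^{−n−1} + O(log log x)
 = Li(x) + O(log log x)`."

Here, for a Beurling system `P` (tree: `BeurlingPrimes`, `primeCount = π_P`, `riemannPrimeCount = Π_P`) and the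
tree's `li`, `Li` (`LiSeries.lean`, with `Σ_{k≥1} li(x^{1/k})/k = Li(x)`):
* `hasSum_primeCount_rpow_div` — `Π_P(x) = Σ_{k≥1} π_P(x^{1/k})/k` (a finite sum: `π_P(x^{1/k}) = 0` once
  `x^{1/k} < λ₀`);
* `exists_abs_riemannPrimeCount_sub_Li_le` — **if `|π_P(y) − li(y)| ≤ A'` for all `y ≥ 1` then
  `|Π_P(x) − Li(x)| ≤ C log log x` for `x ≥ 3`**: the terms with `k ≤ log x/log λ₀` contribute at most
  `A' Σ_{k ≤ log x/log λ₀} 1/k ≤ A'(1 + log log x − log log λ₀)` (Mathlib's `harmonic_le_one_add_log`), and the tail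
  `Σ_{k > log x/log λ₀} li(x^{1/k})/k ≤ Σ_k λ₀ log x/k² ≤ 2 λ₀ log λ₀` (`li(y) ≤ Li(y) ≤ y − 1 ≤ y log y` and
  Mathlib's `sum_Ioo_inv_sq_le`).

## References
* [BrouckeVindas2024] F. Broucke, J. Vindas, *A new generalized prime random approximation procedure and some of
  its applications*, Math. Z. 307 (2024), arXiv:2102.08478, proof of Theorem 3.1 (read).
-/

noncomputable section

open Filter Set Real Finset
open scoped Topology

namespace Literature.NumberTheory.BeurlingPrimes

open Literature.Barriers.RiemannHypothesis

variable (P : BeurlingPrimes)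

/-! ### `Π_P(x) = Σ_k π_P(x^{1/k})/k` -/

/-- `p^{k+1} ≤ x ↔ p ≤ x^{1/(k+1)}` for `p, x ≥ 0`. [folklore] -/
theorem pow_succ_le_iff_le_rpow {p x : ℝ} (hp : 0 ≤ p) (hx : 0 ≤ x) (k : ℕ) :
    p ^ (k + 1) ≤ x ↔ p ≤ x ^ (1 / ((k : ℝ) + 1)) := by
  have hn : k + 1 ≠ 0 := Nat.succ_ne_zero k
  have hcast : (1 / ((k : ℝ) + 1)) = ((k + 1 : ℕ) : ℝ)⁻¹ := by push_cast; ring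
  rw [hcast]
  constructor
  · intro h
    calc p = (p ^ (k + 1)) ^ (((k + 1 : ℕ) : ℝ)⁻¹) := (Real.pow_rpow_inv_natCast hp hn).symm
      _ ≤ x ^ (((k + 1 : ℕ) : ℝ)⁻¹) := Real.rpow_le_rpow (pow_nonneg hp _) h (by positivity)
  · intro h
    calc p ^ (k + 1) ≤ (x ^ (((k + 1 : ℕ) : ℝ)⁻¹)) ^ (k + 1) := pow_le_pow_left₀ hp h _
      _ = x := Real.rpow_inv_natCast_pow hx hn

/-- The fibre over `k`: `Σ_j (1/(k+1)) [λ_j^{k+1} ≤ x] = π_P(x^{1/(k+1)})/(k+1)` (`x ≥ 0`).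
[cite: BrouckeVindas2024, proof of Theorem 3.1] -/
theorem hasSum_fiber_primeCount {x : ℝ} (hx : 0 ≤ x) (k : ℕ) :
    HasSum (fun j : ℕ ↦ if P.prime j ^ (k + 1) ≤ x then 1 / ((k : ℝ) + 1) else 0)
      ((P.primeCount (x ^ (1 / ((k : ℝ) + 1))) : ℝ) / (k + 1)) := by
  set y : ℝ := x ^ (1 / ((k : ℝ) + 1)) with hy
  have hiff : ∀ j, P.prime j ^ (k + 1) ≤ x ↔ j < P.indexOf y := fun j ↦
    (pow_succ_le_iff_le_rpow (P.prime_pos j).le hx k).trans P.prime_le_iff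
  have hfun : (fun j : ℕ ↦ if P.prime j ^ (k + 1) ≤ x then 1 / ((k : ℝ) + 1) else 0) =
      fun j ↦ if j < P.indexOf y then 1 / ((k : ℝ) + 1) else 0 := by
    funext j
    by_cases hj : j < P.indexOf y
    · rw [if_pos ((hiff j).mpr hj), if_pos hj]
    · rw [if_neg (mt (hiff j).mp hj), if_neg hj]
  rw [hfun, P.primeCount_eq_indexOf]
  have h : HasSum (fun j : ℕ ↦ if j < P.indexOf y then 1 / ((k : ℝ) + 1) else 0)
      (∑ j ∈ Finset.range (P.indexOf y), (if j < P.indexOf y then 1 / ((k : ℝ) + 1) else 0)) :=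
    hasSum_sum_of_ne_finset_zero fun j hj ↦ by rw [Finset.mem_range] at hj; rw [if_neg hj]
  have hval : ∑ j ∈ Finset.range (P.indexOf y), (if j < P.indexOf y then 1 / ((k : ℝ) + 1) else 0) =
      ((P.indexOf y : ℕ) : ℝ) / (k + 1) := by
    rw [Finset.sum_congr rfl (g := fun _ ↦ 1 / ((k : ℝ) + 1)) fun j hj ↦ by
      rw [Finset.mem_range] at hj; rw [if_pos hj], Finset.sum_const, Finset.card_range, nsmul_eq_mul]
    ring
  rwa [hval] at h

/-- **`Π_P(x) = Σ_{k≥1} π_P(x^{1/k})/k`** (`x ≥ 0`; a finitely supported series).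
[cite: BrouckeVindas2024, proof of Theorem 3.1] -/
theorem hasSum_primeCount_rpow_div {x : ℝ} (hx : 0 ≤ x) :
    HasSum (fun k : ℕ ↦ (P.primeCount (x ^ (1 / ((k : ℝ) + 1))) : ℝ) / (k + 1)) (P.riemannPrimeCount x) := by
  have h := P.hasSum_riemannPrimeCount x
  have hswap := (Equiv.prodComm ℕ ℕ).hasSum_iff.mpr h
  refine hswap.prod_fiberwise fun k ↦ ?_
  have hf := hasSum_fiber_primeCount P hx k
  refine hf.congr_fun fun j ↦ ?_
  simp

/-! ### `Π_P(x) − Li(x) = O(log log x)` -/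

/-- `y − 1 ≤ y log y` for `y ≥ 1` (`log y ≥ 1 − 1/y`). [folklore] -/
theorem sub_one_le_mul_log {y : ℝ} (hy : 1 ≤ y) : y - 1 ≤ y * Real.log y := by
  have h := Real.one_sub_inv_le_log_of_pos (by linarith : 0 < y)
  have hy0 : 0 < y := by linarith
  have : y * (1 - y⁻¹) = y - 1 := by field_simp
  nlinarith

/-- The casted harmonic number: `Σ_{k<N} 1/(k+1) ≤ 1 + log N` (Mathlib's `harmonic_le_one_add_log`; a private
copy of a folklore bound also proved in `LFunctions/MontgomeryZeroSideProofs.lean`, kept local to avoid that import).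
[folklore] -/
private theorem sum_range_inv_le_log (N : ℕ) : ∑ k ∈ Finset.range N, 1 / ((k : ℝ) + 1) ≤ 1 + Real.log N := by
  have h := harmonic_le_one_add_log N
  have hcast : ((harmonic N : ℚ) : ℝ) = ∑ k ∈ Finset.range N, 1 / ((k : ℝ) + 1) := by
    simp [harmonic, one_div]
  linarith [hcast]

/-- `Σ_k 1/(k+N+1)² ≤ 2/(N+1)` (Mathlib's `sum_Ioo_inv_sq_le`). [folklore] -/
theorem tsum_inv_sq_shift_le (N : ℕ) : ∑' k : ℕ, 1 / (((k + N + 1 : ℕ) : ℝ)) ^ 2 ≤ 2 / ((N : ℝ) + 1) := by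
  refine Real.tsum_le_of_sum_range_le (fun k ↦ by positivity) fun M ↦ ?_
  have h := sum_Ioo_inv_sq_le (α := ℝ) N (N + 1 + M)
  have hre : ∑ k ∈ Finset.range M, 1 / (((k + N + 1 : ℕ) : ℝ)) ^ 2 =
      ∑ i ∈ Finset.Ioo N (N + 1 + M), ((i : ℝ) ^ 2)⁻¹ := by
    rw [← Finset.Ico_succ_left_eq_Ioo, Order.succ_eq_add_one, Finset.sum_Ico_eq_sum_range]
    simp only [show N + 1 + M - (N + 1) = M by omega, one_div]
    refine Finset.sum_congr rfl fun k _ ↦ ?_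
    push_cast
    ring
  rw [hre]
  exact h

/-- **`π_P = li + O(1)` implies `Π_P = Li + O(log log x)`**: if `|π_P(y) − li(y)| ≤ A'` for all `y ≥ 1`, then for
all `x ≥ 3`, `|Π_P(x) − Li(x)| ≤ A'(1 + log log x + |log log λ₀|) + 2 λ₀ log λ₀`.
[cite: BrouckeVindas2024, proof of Theorem 3.1] -/
theorem abs_riemannPrimeCount_sub_Li_le {A' : ℝ} (hπ : ∀ y : ℝ, 1 ≤ y → |(P.primeCount y : ℝ) - li y| ≤ A')
    {x : ℝ} (hx : 3 ≤ x) :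
    |P.riemannPrimeCount x - Li x| ≤
      A' * (1 + Real.log (Real.log x) + |Real.log (Real.log (P.prime 0))|) +
        2 * P.prime 0 * Real.log (P.prime 0) := by
  have hx1 : 1 ≤ x := by linarith
  have hx0 : 0 < x := by linarith
  have hA' : 0 ≤ A' := le_trans (abs_nonneg _) (hπ 1 le_rfl)
  have hp0 : 1 < P.prime 0 := P.one_lt
  have hlp : 0 < Real.log (P.prime 0) := Real.log_pos hp0
  have hlx : 1 < Real.log x := by
    rw [Real.lt_log_iff_exp_lt hx0]
    exact lt_of_lt_of_le (by have := Real.exp_one_lt_d9; linarith) hx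
  have hllx : 0 ≤ Real.log (Real.log x) := Real.log_nonneg hlx.le
  -- the two series and their difference
  set y : ℕ → ℝ := fun k ↦ x ^ (1 / ((k : ℝ) + 1)) with hydef
  have hy1 : ∀ k, 1 ≤ y k := fun k ↦ Real.one_le_rpow hx1 (by positivity)
  have hlogy : ∀ k, Real.log (y k) = Real.log x / ((k : ℝ) + 1) := by
    intro k; rw [hydef]; simp only; rw [Real.log_rpow hx0]; ring
  set d : ℕ → ℝ := fun k ↦ ((P.primeCount (y k) : ℝ) - li (y k)) / ((k : ℝ) + 1) with hddef
  have hd : HasSum d (P.riemannPrimeCount x - Li x) := by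
    have h := (hasSum_primeCount_rpow_div P hx0.le).sub (hasSum_li_rpow_div hx1)
    refine h.congr_fun fun k ↦ ?_
    simp only [hddef, hydef]; ring
  -- the cut-off `N = ⌊log x / log λ₀⌋`
  set N : ℕ := ⌊Real.log x / Real.log (P.prime 0)⌋₊ with hN
  have hNle : (N : ℝ) ≤ Real.log x / Real.log (P.prime 0) := Nat.floor_le (div_nonneg (by linarith) hlp.le)
  have hNlt : Real.log x / Real.log (P.prime 0) < (N : ℝ) + 1 := Nat.lt_floor_add_one _
  -- head: `|Σ_{k<N} d k| ≤ A' (1 + log N) ≤ A'(1 + log log x + |log log λ₀|)`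
  have hhead : |∑ k ∈ Finset.range N, d k| ≤ A' * (1 + Real.log (Real.log x) + |Real.log (Real.log (P.prime 0))|) := by
    have h1 : |∑ k ∈ Finset.range N, d k| ≤ ∑ k ∈ Finset.range N, A' * (1 / ((k : ℝ) + 1)) := by
      refine (Finset.abs_sum_le_sum_abs _ _).trans (Finset.sum_le_sum fun k _ ↦ ?_)
      simp only [hddef, abs_div, abs_of_pos (by positivity : (0 : ℝ) < k + 1)]
      rw [mul_one_div]
      exact div_le_div_of_nonneg_right (hπ (y k) (hy1 k)) (by positivity)
    rw [← Finset.mul_sum] at h1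
    refine h1.trans (mul_le_mul_of_nonneg_left ?_ hA')
    refine (sum_range_inv_le_log N).trans ?_
    rcases Nat.eq_zero_or_pos N with hN0 | hNpos
    · rw [hN0]; simp; linarith [abs_nonneg (Real.log (Real.log (P.prime 0)))]
    · have hN1 : (0 : ℝ) < N := by exact_mod_cast hNpos
      have hlogN : Real.log N ≤ Real.log (Real.log x) - Real.log (Real.log (P.prime 0)) := by
        rw [← Real.log_div (by linarith) hlp.ne']
        exact Real.log_le_log hN1 hNle
      linarith [neg_abs_le (Real.log (Real.log (P.prime 0)))]
  -- tail: for `k ≥ N`, `π_P(y_k) = 0` and `0 ≤ li(y_k) ≤ λ₀ log x/(k+1)`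
  have htail_pt : ∀ k : ℕ, |d (k + N)| ≤ P.prime 0 * Real.log x * (1 / (((k + N + 1 : ℕ) : ℝ)) ^ 2) := by
    intro k
    have hk1 : (0 : ℝ) < (k : ℝ) + N + 1 := by positivity
    -- `y_{k+N} < λ₀`
    have hylt : y (k + N) < P.prime 0 := by
      have hlog : Real.log (y (k + N)) < Real.log (P.prime 0) := by
        rw [hlogy, div_lt_iff₀ (by push_cast; positivity)]
        calc Real.log x = Real.log x / Real.log (P.prime 0) * Real.log (P.prime 0) := by field_simp
          _ < ((N : ℝ) + 1) * Real.log (P.prime 0) := mul_lt_mul_of_pos_right hNlt hlp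
          _ ≤ (((k + N : ℕ) : ℝ) + 1) * Real.log (P.prime 0) := by
              refine mul_le_mul_of_nonneg_right ?_ hlp.le; push_cast; linarith [(Nat.cast_nonneg k : (0:ℝ) ≤ k)]
          _ = Real.log (P.prime 0) * (((k + N : ℕ) : ℝ) + 1) := by ring
      exact (Real.log_lt_log_iff (by linarith [hy1 (k + N)]) (by linarith)).mp hlog
    have hπ0 : P.primeCount (y (k + N)) = 0 := by
      rw [P.primeCount_eq_indexOf]; exact P.indexOf_eq_zero_of_lt_prime_zero hylt
    have hli : li (y (k + N)) ≤ P.prime 0 * Real.log x / (((k + N : ℕ) : ℝ) + 1) := by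
      have h1 : li (y (k + N)) ≤ y (k + N) * Real.log (y (k + N)) :=
        (li_le_Li (hy1 _)).trans ((Li_le_sub_one (hy1 _)).trans (sub_one_le_mul_log (hy1 _)))
      rw [hlogy] at h1
      refine h1.trans ?_
      rw [mul_div_assoc]
      push_cast
      exact mul_le_mul_of_nonneg_right hylt.le (div_nonneg (by linarith) (by positivity))
    simp only [hddef, hπ0, Nat.cast_zero, zero_sub, abs_div, abs_neg, abs_of_nonneg (li_nonneg (y (k + N)))]
    rw [abs_of_pos (by positivity : (0:ℝ) < ((k + N : ℕ) : ℝ) + 1), div_le_iff₀ (by positivity)]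
    refine hli.trans (le_of_eq ?_)
    push_cast
    field_simp
  have hsum2 : Summable fun k : ℕ ↦ 1 / (((k + N + 1 : ℕ) : ℝ)) ^ 2 := by
    have := (summable_nat_add_iff (N + 1)).mpr (Real.summable_one_div_nat_pow.mpr one_lt_two)
    refine this.congr fun k ↦ ?_
    push_cast; ring_nf
  have htail_sum : Summable fun k ↦ d (k + N) := hd.summable.comp_injective (add_left_injective N)
  have htail : |∑' k, d (k + N)| ≤ 2 * P.prime 0 * Real.log (P.prime 0) := by
    have h1 : ‖∑' k, d (k + N)‖ ≤ ∑' k, P.prime 0 * Real.log x * (1 / (((k + N + 1 : ℕ) : ℝ)) ^ 2) :=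
      tsum_of_norm_bounded (hsum2.mul_left _).hasSum fun k ↦ by rw [Real.norm_eq_abs]; exact htail_pt k
    rw [Real.norm_eq_abs, tsum_mul_left] at h1
    refine h1.trans ?_
    have h2 := tsum_inv_sq_shift_le N
    have hlx0 : 0 ≤ P.prime 0 * Real.log x := mul_nonneg (by linarith) (by linarith)
    calc P.prime 0 * Real.log x * ∑' k : ℕ, 1 / (((k + N + 1 : ℕ) : ℝ)) ^ 2
        ≤ P.prime 0 * Real.log x * (2 / ((N : ℝ) + 1)) := mul_le_mul_of_nonneg_left h2 hlx0
      _ = 2 * P.prime 0 * (Real.log x / ((N : ℝ) + 1)) := by ring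
      _ ≤ 2 * P.prime 0 * Real.log (P.prime 0) := by
          refine mul_le_mul_of_nonneg_left ?_ (by linarith)
          rw [div_le_iff₀ (by positivity)]
          calc Real.log x = Real.log x / Real.log (P.prime 0) * Real.log (P.prime 0) := by field_simp
            _ ≤ ((N : ℝ) + 1) * Real.log (P.prime 0) := mul_le_mul_of_nonneg_right hNlt.le hlp.le
            _ = Real.log (P.prime 0) * ((N : ℝ) + 1) := by ring
  -- assemble
  have hsplit : P.riemannPrimeCount x - Li x = ∑ k ∈ Finset.range N, d k + ∑' k, d (k + N) := by
    rw [← hd.tsum_eq]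
    exact (hd.summable.sum_add_tsum_nat_add N).symm
  rw [hsplit]
  exact (abs_add_le _ _).trans (add_le_add hhead htail)

/-- **BV Theorem 3.1, the prime clause, from `π_P = li + O(1)`**: if `|π_P(y) − li(y)| ≤ A'` for `y ≥ 1` then there
is `C` with `|Π_P(x) − Li(x)| ≤ C log log x` for all `x ≥ 3`. [cite: BrouckeVindas2024, Theorem 3.1 (proof)] -/
theorem exists_abs_riemannPrimeCount_sub_Li_le {A' : ℝ}
    (hπ : ∀ y : ℝ, 1 ≤ y → |(P.primeCount y : ℝ) - li y| ≤ A') :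
    ∃ C : ℝ, ∀ x : ℝ, 3 ≤ x → |P.riemannPrimeCount x - Li x| ≤ C * Real.log (Real.log x) := by
  have hA' : 0 ≤ A' := le_trans (abs_nonneg _) (hπ 1 le_rfl)
  -- the constant part `D` is absorbed using `log log x ≥ log log 3 > 0`
  set D : ℝ := A' * (1 + |Real.log (Real.log (P.prime 0))|) + 2 * P.prime 0 * Real.log (P.prime 0) with hD
  have hl3 : 0 < Real.log (Real.log 3) := by
    refine Real.log_pos ?_
    rw [Real.lt_log_iff_exp_lt (by norm_num)]
    have := Real.exp_one_lt_d9; linarith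
  have hD0 : 0 ≤ D := by
    have : 0 ≤ 2 * P.prime 0 * Real.log (P.prime 0) :=
      mul_nonneg (by linarith [P.one_lt]) (Real.log_nonneg P.one_lt.le)
    exact add_nonneg (mul_nonneg hA' (by positivity)) this
  refine ⟨A' + D / Real.log (Real.log 3), fun x hx ↦ ?_⟩
  have h := abs_riemannPrimeCount_sub_Li_le P hπ hx
  have hll : Real.log (Real.log 3) ≤ Real.log (Real.log x) :=
    Real.log_le_log (Real.log_pos (by norm_num)) (Real.log_le_log (by norm_num) hx)
  have hllx : 0 < Real.log (Real.log x) := lt_of_lt_of_le hl3 hll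
  have hD' : D ≤ D / Real.log (Real.log 3) * Real.log (Real.log x) := by
    rw [div_mul_eq_mul_div, le_div_iff₀ hl3]
    exact mul_le_mul_of_nonneg_left hll hD0
  calc |P.riemannPrimeCount x - Li x|
      ≤ A' * (1 + Real.log (Real.log x) + |Real.log (Real.log (P.prime 0))|) + 2 * P.prime 0 * Real.log (P.prime 0) := h
    _ = A' * Real.log (Real.log x) + D := by rw [hD]; ring
    _ ≤ A' * Real.log (Real.log x) + D / Real.log (Real.log 3) * Real.log (Real.log x) := by linarith
    _ = (A' + D / Real.log (Real.log 3)) * Real.log (Real.log x) := by ring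

end Literature.NumberTheory.BeurlingPrimes
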